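import Summits.CriticalPhenomena.CardyFormulaZ2.Theorems.CardyFlipRussoQuadrupoleSelectionRulePoissonPerturbation
import Literature.Analysis.FunctionSpaces.PoissonPointProcessUniqueness
import Mathlib.Analysis.Calculus.Deriv.Add
import Mathlib.Analysis.Calculus.Deriv.Comp

/-!
# The Poisson perturbation (Margulis–Russo) formula at every leg parameter `t₀ ≥ 0`

Helper file for the crux `QuadrupoleSelectionRule` (stmt-CriticalPhenomena-7029, informal) of
route `CardyFlipRusso` (sub-problem `CardyFormulaZ2`), line `Sketch` (generation 3), stub G2:
the two-sided-in-`t` form of the Poisson perturbation formula for the superposition leg L2/L3 of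
the Voronoi hub. Superpose on a "rest" configuration `c` (any finite law `P`) an independent
Poisson process `c'_t` of intensity `t • ρ` (`ρ` finite and atomless, law `Q t`); the annealed
observable `f(t) = ∫ F(c ∪ c') d(P ⊗ Q_t)` of a bounded measurable `F` has, at EVERY `t₀ ≥ 0`,
right derivative the expected insertion effect at `t₀`,
`∫ (∫ F(c ∪ c' ∪ {x}) d(P ⊗ Q_{t₀}) - ∫ F(c ∪ c') d(P ⊗ Q_{t₀})) ρ(dx)`
(G. Last, M. Penrose, *Lectures on the Poisson Process* (2017), Thm 19.1, the perturbation /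
Margulis–Russo formula for Poisson functionals, for bounded `F` and finite intensity).

Proof. The one-sided formula at `t = 0` is the tree's
`hasDerivWithinAt_integral_union_poisson` (file
`CardyFlipRussoQuadrupoleSelectionRulePoissonPerturbation.lean`). For `s ≥ 0` both `Q_{t₀+s}`
and the superposition `(Q_{t₀} ⊗ Q_s) ∘ (∪)⁻¹` are Poisson of intensity
`(t₀ + s) • ρ = t₀ • ρ + s • ρ` — the latter by the Superposition Theorem
`IsPoissonPointProcess.superposition_holds` (Kingman 1993, §2.2) — hence equal in law by Rényi
uniqueness `IsPoissonPointProcess.unique_holds` (`eq_map_union_prod_of_isPoissonPointProcess`).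
By associativity of superposition, at the level of configurations (`union_assoc_pointConfig`) and
of laws (`map_union_prod_map_union`), `f(t₀ + s)` is the observable at `s` for the new rest
`P' = (P ⊗ Q_{t₀}) ∘ (∪)⁻¹`, to which the one-sided formula applies; its derivative value unfolds
to the stated one (`MeasureTheory.integral_map`), and the right derivative is transported from `0`
within `[0, ∞)` to `t₀` within `[t₀, ∞)` along `t ↦ t - t₀` (chain rule).

Main statement: `hasDerivWithinAt_integral_union_poisson_at`.
-/

noncomputable section

open MeasureTheory ProbabilityTheory Filter Set
open scoped ENNReal NNReal Topology

namespace Summit.CriticalPhenomena.CardyFormulaZ2.Theorems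

open Literature.Analysis.FunctionSpaces

section Config

variable {E : Type*} [TopologicalSpace E]

/-- Superposition of configurations is associative: `(c ∪ d) ∪ e = c ∪ (d ∪ e)`. [folklore] -/
theorem union_assoc_pointConfig (c d e : PointConfig E) : c ∪ d ∪ e = c ∪ (d ∪ e) :=
  SetLike.ext' (show (c ∪ d ∪ e).carrier = (c ∪ (d ∪ e)).carrier by
    simp only [PointConfig.carrier_union, Set.union_assoc])

end Config

section Poisson

variable {E : Type*} [TopologicalSpace E] [T2Space E] [SecondCountableTopology E]
  [MeasurableSpace E] [BorelSpace E]

/-- **Associativity of superposition, at the level of laws.** For s-finite laws `P, Q, R` of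
configurations, superposing (a sample of) `P` with the superposition of `Q` and `R` has the same
law as superposing the superposition of `P` and `Q` with `R`:
`(P ⊗ (Q ⊗ R)∘(∪)⁻¹) ∘ (∪)⁻¹ = ((P ⊗ Q)∘(∪)⁻¹ ⊗ R) ∘ (∪)⁻¹` — push the maps through the
products, reassociate the triple product (`MeasureTheory.measurePreserving_prodAssoc`) and use
`(c ∪ d) ∪ e = c ∪ (d ∪ e)`. [folklore] -/
theorem map_union_prod_map_union (P Q R : Measure (PointConfig E)) [SFinite P] [SFinite Q]
    [SFinite R] :
    (P.prod ((Q.prod R).map fun p : PointConfig E × PointConfig E => p.1 ∪ p.2)).map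
        (fun p : PointConfig E × PointConfig E => p.1 ∪ p.2) =
      (((P.prod Q).map fun p : PointConfig E × PointConfig E => p.1 ∪ p.2).prod R).map
        fun p : PointConfig E × PointConfig E => p.1 ∪ p.2 := by
  have hU : Measurable fun p : PointConfig E × PointConfig E => p.1 ∪ p.2 :=
    PointConfig.measurable_union'
  have eL : P.prod ((Q.prod R).map fun p : PointConfig E × PointConfig E => p.1 ∪ p.2) =
      (P.prod (Q.prod R)).map
        (Prod.map id fun p : PointConfig E × PointConfig E => p.1 ∪ p.2) := by
    rw [← Measure.map_prod_map P (Q.prod R) measurable_id hU, Measure.map_id]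
  have eR : ((P.prod Q).map fun p : PointConfig E × PointConfig E => p.1 ∪ p.2).prod R =
      ((P.prod Q).prod R).map
        (Prod.map (fun p : PointConfig E × PointConfig E => p.1 ∪ p.2) id) := by
    rw [← Measure.map_prod_map (P.prod Q) R hU measurable_id, Measure.map_id]
  rw [eL, eR, Measure.map_map hU (measurable_id.prodMap hU),
    Measure.map_map hU (hU.prodMap measurable_id),
    ← (measurePreserving_prodAssoc P Q R).map_eq,
    Measure.map_map (hU.comp (measurable_id.prodMap hU))
      (MeasurableEquiv.prodAssoc :
        (PointConfig E × PointConfig E) × PointConfig E ≃ᵐ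
          PointConfig E × PointConfig E × PointConfig E).measurable]
  congr 1
  funext r
  exact (union_assoc_pointConfig r.1.1 r.1.2 r.2).symm

/-- **A Poisson family in the intensity parameter is a superposition semigroup in law.** If
`Q t` is a Poisson point process of intensity `t • ρ` for every `t ≥ 0` (`ρ` finite), then for
`t, s ≥ 0` the law `Q (t + s)` is the law of the superposition of independent samples of `Q t` and
`Q s`: both are Poisson of intensity `(t + s) • ρ = t • ρ + s • ρ`, the latter by the
Superposition Theorem (Kingman 1993, §2.2; `IsPoissonPointProcess.superposition_holds`), so they
agree by uniqueness in law for a σ-finite intensity (Rényi 1967;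
`IsPoissonPointProcess.unique_holds`). [cite: Kingman1993, §2.2] -/
theorem eq_map_union_prod_of_isPoissonPointProcess (ρ : Measure E) [IsFiniteMeasure ρ]
    {Q : ℝ → Measure (PointConfig E)}
    (hQ : ∀ t, 0 ≤ t → IsPoissonPointProcess ((ENNReal.ofReal t) • ρ) (Q t))
    {t s : ℝ} (ht : 0 ≤ t) (hs : 0 ≤ s) :
    Q (t + s) = ((Q t).prod (Q s)).map fun p : PointConfig E × PointConfig E => p.1 ∪ p.2 := by
  haveI : IsFiniteMeasure ((ENNReal.ofReal t) • ρ) := Measure.smul_finite ρ ENNReal.ofReal_ne_top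
  haveI : IsFiniteMeasure ((ENNReal.ofReal s) • ρ) := Measure.smul_finite ρ ENNReal.ofReal_ne_top
  haveI : IsFiniteMeasure ((ENNReal.ofReal (t + s)) • ρ) :=
    Measure.smul_finite ρ ENNReal.ofReal_ne_top
  have hsup : IsPoissonPointProcess ((ENNReal.ofReal t) • ρ + (ENNReal.ofReal s) • ρ)
      (((Q t).prod (Q s)).map fun p : PointConfig E × PointConfig E => p.1 ∪ p.2) :=
    IsPoissonPointProcess.superposition_holds (hQ t ht) (hQ s hs)
  rw [← add_smul, ← ENNReal.ofReal_add ht hs] at hsup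
  exact IsPoissonPointProcess.unique_holds (hQ (t + s) (add_nonneg ht hs)) hsup

/-- **The Poisson perturbation (Margulis–Russo) formula for the superposition leg, at every leg
parameter.** Let `P` be any finite law of a "rest" configuration, `ρ` a finite atomless measure,
and `Q t` (for `t ≥ 0`) a Poisson point process of intensity `t • ρ`. For bounded measurable `F`
and every `t₀ ≥ 0`, the annealed observable `t ↦ ∫ F(c ∪ c') d(P ⊗ Q_t)` has right derivative at
`t₀` equal to the expected insertion effect at `t₀`,
`∫ (∫ F(c ∪ c' ∪ {x}) d(P ⊗ Q_{t₀}) - ∫ F(c ∪ c') d(P ⊗ Q_{t₀})) ρ(dx)` (Last–Penrose 2017,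
Thm 19.1). Reduced to the one-sided formula at `0` (`hasDerivWithinAt_integral_union_poisson`)
for the rest `(P ⊗ Q_{t₀}) ∘ (∪)⁻¹`, since `Q_{t₀+s}` is the superposition of `Q_{t₀}` and `Q_s`
in law (`eq_map_union_prod_of_isPoissonPointProcess`, `map_union_prod_map_union`).
[cite: LastPenrose2017, Thm 19.1] -/
theorem hasDerivWithinAt_integral_union_poisson_at
    (P : Measure (PointConfig E)) [IsFiniteMeasure P]
    (ρ : Measure E) [IsFiniteMeasure ρ] (hρ : ∀ x, ρ {x} = 0)
    (Q : ℝ → Measure (PointConfig E))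
    (hQ : ∀ t, 0 ≤ t → IsPoissonPointProcess ((ENNReal.ofReal t) • ρ) (Q t))
    (F : PointConfig E → ℝ) (hFm : Measurable F) (M : ℝ) (hFb : ∀ c, |F c| ≤ M)
    (t₀ : ℝ) (ht₀ : 0 ≤ t₀) :
    HasDerivWithinAt (fun t : ℝ => ∫ p, F (p.1 ∪ p.2) ∂(P.prod (Q t)))
      (∫ x, ((∫ p, F (p.1 ∪ p.2 ∪ PointConfig.ofFn ![x]) ∂(P.prod (Q t₀))) -
          ∫ p, F (p.1 ∪ p.2) ∂(P.prod (Q t₀))) ∂ρ)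
      (Set.Ici t₀) t₀ := by
  have hU : Measurable fun p : PointConfig E × PointConfig E => p.1 ∪ p.2 :=
    PointConfig.measurable_union'
  have hUc : ∀ d : PointConfig E, Measurable fun c : PointConfig E => c ∪ d := fun d =>
    hU.comp (measurable_id.prodMk measurable_const)
  haveI := (hQ t₀ ht₀).isProbabilityMeasure
  -- the observable is the integral of `F` against the law of the superposition
  have hint : ∀ μ : Measure (PointConfig E × PointConfig E), ∫ p, F (p.1 ∪ p.2) ∂μ =
      ∫ c, F c ∂(μ.map fun p : PointConfig E × PointConfig E => p.1 ∪ p.2) :=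
    fun μ => (integral_map hU.aemeasurable hFm.aestronglyMeasurable).symm
  -- the observable at `t₀ + s` is the observable at `s` for the rest `P' = (P ⊗ Q t₀) ∘ (∪)⁻¹`
  have hobs : ∀ s, 0 ≤ s → ∫ p, F (p.1 ∪ p.2) ∂(P.prod (Q (t₀ + s))) =
      ∫ p, F (p.1 ∪ p.2) ∂(((P.prod (Q t₀)).map
        fun p : PointConfig E × PointConfig E => p.1 ∪ p.2).prod (Q s)) := by
    intro s hs
    haveI := (hQ s hs).isProbabilityMeasure
    rw [hint, hint, eq_map_union_prod_of_isPoissonPointProcess ρ hQ ht₀ hs,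
      map_union_prod_map_union P (Q t₀) (Q s)]
  -- the one-sided formula at `0` for the rest `P'`
  have h0 := hasDerivWithinAt_integral_union_poisson
    ((P.prod (Q t₀)).map fun p : PointConfig E × PointConfig E => p.1 ∪ p.2) ρ hρ Q hQ F hFm M hFb
  -- its derivative value is the stated one
  have hD : (∫ x, ((∫ c, F (c ∪ PointConfig.ofFn ![x]) ∂((P.prod (Q t₀)).map
      fun p : PointConfig E × PointConfig E => p.1 ∪ p.2)) -
        ∫ c, F c ∂((P.prod (Q t₀)).map fun p : PointConfig E × PointConfig E => p.1 ∪ p.2)) ∂ρ) =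
      ∫ x, ((∫ p, F (p.1 ∪ p.2 ∪ PointConfig.ofFn ![x]) ∂(P.prod (Q t₀))) -
        ∫ p, F (p.1 ∪ p.2) ∂(P.prod (Q t₀))) ∂ρ := by
    refine integral_congr_ae (Eventually.of_forall fun x => ?_)
    dsimp only
    have hm : AEStronglyMeasurable (fun c : PointConfig E => F (c ∪ PointConfig.ofFn ![x]))
        ((P.prod (Q t₀)).map fun p : PointConfig E × PointConfig E => p.1 ∪ p.2) :=
      (hFm.comp (hUc _)).aestronglyMeasurable
    rw [integral_map hU.aemeasurable hm, integral_map hU.aemeasurable hFm.aestronglyMeasurable]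
  -- transport the right derivative from `0` to `t₀` along `t ↦ t - t₀`
  have h1 := (h0.congr_deriv hD).comp_of_eq t₀ ((hasDerivWithinAt_id t₀ (Ici t₀)).sub_const t₀)
    (fun t ht => mem_Ici.2 (sub_nonneg.2 (mem_Ici.1 ht))) (sub_self t₀).symm
  rw [mul_one] at h1
  refine h1.congr_of_mem (fun t ht => ?_) (mem_Ici.2 le_rfl)
  have hs : 0 ≤ t - t₀ := sub_nonneg.2 (mem_Ici.1 ht)
  have h2 := hobs (t - t₀) hs
  rw [add_sub_cancel] at h2
  simpa only [Function.comp_apply, id_eq] using h2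

end Poisson

end Summit.CriticalPhenomena.CardyFormulaZ2.Theorems

end
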